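import Summits.QuantumFields.YangMills.Theorems.BalabanUVNodesN07Delta2OfRecordReal
import Summits.QuantumFields.YangMills.Theorems.BalabanUVNodesN07COfRecordRealSlice
import HarnessLib

/-!
# NODE N07 — `C⁽²⁾ = quadPart C^{𝔰𝔩}` COMMUTES WITH `A ↦ Aᴴ` AT EVERY GUARDED `SU(N)` BACKGROUND (the letter `hC2` of ✓`…N07Delta2OfRecordReal` DISCHARGED), HENCE
# 3g′'s TOKEN `HessSymmTok Δ2` HOLDS FOR THE (3.134) DATUM `Δ⁽²⁾` WITH NO NONLINEAR LETTER LEFT ([B9] (3.134)–(3.135) p. 422; [15] (44), (56), (78)–(79))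

Cell `pub-ymgap`, width seat `pub-ymgap-dag-n07-w3` (g26), CLAIM-6.  `--kind proof --supports stmt-QuantumFields-27238 --as helper`; count-neutral.
[15] = [Balaban1985Variational]; [B9] = [Balaban1985BackgroundPropagators].

THE ARGUMENT (polarisation of an analytic germ that is real on the real slice).  `C^{𝔰𝔩}` is ℂ-analytic at `0` under the guard (3f′ ✓`analyticAt_CslOfRecord_zero`) and maps
the HERMITIAN lines `t ↦ tA′` (`t` real, small) into Hermitian block fields (✓`N07COfRecordRealSlice.CslOfRecord_line_conj_eventually`).  Differentiating twice along such
a line inside the CLOSED real subspace of Hermitian block fields (§1: the derivative of a curve that lies in a closed real subspace lies in it) puts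
`D²C^{𝔰𝔩}(0)(A′, A′)` in that subspace for every Hermitian `A′` (§3).  Since `(A′, B′) ↦ D²C^{𝔰𝔩}(0)(A′, B′)` is ℂ-bilinear, writing a general `A′ = A₁ + iA₂` with
`A₁, A₂` Hermitian and polarising the diagonal gives `D²C^{𝔰𝔩}(0)(A′ᴴ, A′ᴴ) = (D²C^{𝔰𝔩}(0)(A′, A′))ᴴ` (§4), i.e. `hC2`; §5 feeds it to ✓`hessSymmTok_of_delta2Tok`.
* §1 `fixed_of_hasDerivAt` (generic: closed fixed set of a continuous real-affine involution-like map captures derivatives).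
* §2 the two conjugations: `conjJet_*` on the space (115) of record, `conjNeg_*` on the block fields (additive, conjugate-homogeneous, involutive; the block one continuous).
* §3 ★★ `conjNeg_sndFDeriv_of_herm` — `(D²C^{𝔰𝔩}(0)(A′,A′))ᴴ = D²C^{𝔰𝔩}(0)(A′,A′)` for Hermitian `A′` (guard).
* §4 ★★★ `quadPart_CslOfRecord_conj` — THE LETTER `hC2`: `quadPart C^{𝔰𝔩} (A′ᴴ) = (quadPart C^{𝔰𝔩} A′)ᴴ` for EVERY `A′` (guard).
* §5 ★★★ `realConj_delta2_eq_self`, ★★★ `hessSymmTok_of_delta2Tok_of_delta2SymmTok` — at every guarded background, for every `Δ2` with `Delta2Tok ∧ Delta2SymmTok`: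
  `Δ2` is real and `HessSymmTok F N K k U₀ Δ2` (3g′'s third scheme token for print's `Δ⁽²⁾`; the binders are the scheme's own `hpos♭`, `hQ` and 35b's guard).

HONEST LABELS.  Calculus∕`*`-algebra bookkeeping over the tree's constructed letters; NO estimate of the series; nothing of `RegimeTok` ((R1)(R2)) or `ChartSUTok`.
Count-neutral; N07 NOT discharged; P0 ⟨26900⟩ OPEN; R4 is the conditional finite-𝕋⁴ rung only.  Nothing here is a claim about the Yang–Mills mass gap
(`Summit.QuantumFields`): finite torus, fixed `ε`; nothing continuum ∕ OS ∕ Clay.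
-/

set_option autoImplicit false

noncomputable section

open scoped Matrix Matrix.Norms.L2Operator InnerProductSpace ComplexConjugate Topology

namespace Summit.QuantumFields.YangMills.Theorems.N07QuadPartReality

open Filter
open Literature.MathematicalPhysics.QuantumFieldTheory.Balaban1983to89
open Literature.MathematicalPhysics.QuantumFieldTheory.Balaban1983to89.T4Continuum (T4Family)
open T4Continuum BlockAveraging
open B9SectCLatticeCarrier (Bond)
open B9Eq311TracePairing (starW realConj)
open B11Eq111FrakG (nabla115)
open B11Eq103H1Complex (BondL2K)
open B11Eq115Space (NegSize NegSup levWeight JetSup)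
open B11Eq80Current (quadPart)
open B9Eq3119DeltaPiReality (realConj_eq_self_iff)
open Node00
open Summit.QuantumFields.YangMills.Theorems.N07COfRecordRealSlice (CslOfRecord_line_conj_eventually)
open Summit.QuantumFields.YangMills.Theorems.N07Delta2OfRecordReal (realConj_eq_self_of_delta2Tok hessSymmTok_of_delta2Tok)

/-! ## §1  Generic: a closed real "fixed set" captures derivatives of curves lying in it -/

section Generic

variable {G : Type*} [NormedAddCommGroup G] [NormedSpace ℝ G]

/-- **THE DERIVATIVE OF A CURVE LYING IN THE FIXED SET OF A CONTINUOUS REAL-AFFINE MAP LIES IN IT** (difference quotients stay in the closed fixed set).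
[folklore] [cite: Balaban1985Variational, (56) p.286 (where it is used: the second-order part of a real map is real)] -/
theorem fixed_of_hasDerivAt {σ : G → G} (hσc : Continuous σ) (hσ : ∀ (r : ℝ) (a b : G), σ (r • (a - b)) = r • (σ a - σ b))
    {ψ : ℝ → G} {v : G} {t : ℝ} (hψ : ∀ᶠ s in 𝓝 t, σ (ψ s) = ψ s) (hd : HasDerivAt ψ v t) : σ v = v := by
  have hclosed : IsClosed {z : G | σ z = z} := isClosed_eq hσc continuous_id
  rw [hasDerivAt_iff_tendsto_slope] at hd
  have ht : σ (ψ t) = ψ t := hψ.self_of_nhds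
  have hev : ∀ᶠ s in 𝓝[≠] t, slope ψ t s ∈ {z : G | σ z = z} := by
    filter_upwards [nhdsWithin_le_nhds hψ] with s hs
    show σ (slope ψ t s) = slope ψ t s
    rw [slope_def_module, hσ, hs, ht]
  exact hclosed.mem_of_tendsto hd hev

end Generic

/-! ## §2  The two conjugations at the record -/

section Conj

variable (F : T4Family) (N : ℕ) (K : ℕ) (k : ℕ) (Ω : ℕ → Set (Site (F.P K) 0)) (U₀ : GaugeField (F.P K) 0 (SU N))

/-- `(A + B)ᴴ = Aᴴ + Bᴴ` on the space (115) of record. [cite: Balaban1985Variational, (115) p.294 (bookkeeping)] -/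
theorem conjJet_add (A B : Space115Lit F N K k Ω U₀) :
    ((JetSup.equiv _ _ (nabla115 ((F.P K).eta k) (unitsOfRecord F N U₀))).symm
        (star (JetSup.equiv _ _ (nabla115 ((F.P K).eta k) (unitsOfRecord F N U₀)) (A + B))) : Space115Lit F N K k Ω U₀) =
      (JetSup.equiv _ _ (nabla115 ((F.P K).eta k) (unitsOfRecord F N U₀))).symm
          (star (JetSup.equiv _ _ (nabla115 ((F.P K).eta k) (unitsOfRecord F N U₀)) A)) +
        (JetSup.equiv _ _ (nabla115 ((F.P K).eta k) (unitsOfRecord F N U₀))).symm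
          (star (JetSup.equiv _ _ (nabla115 ((F.P K).eta k) (unitsOfRecord F N U₀)) B)) := by
  apply (JetSup.equiv _ _ (nabla115 ((F.P K).eta k) (unitsOfRecord F N U₀))).injective
  rw [Equiv.apply_symm_apply, JetSup.equiv_add, JetSup.equiv_add, Equiv.apply_symm_apply, Equiv.apply_symm_apply, star_add]

/-- `(A − B)ᴴ = Aᴴ − Bᴴ` on the space (115) of record. [cite: Balaban1985Variational, (115) p.294 (bookkeeping)] -/
theorem conjJet_sub (A B : Space115Lit F N K k Ω U₀) :
    ((JetSup.equiv _ _ (nabla115 ((F.P K).eta k) (unitsOfRecord F N U₀))).symm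
        (star (JetSup.equiv _ _ (nabla115 ((F.P K).eta k) (unitsOfRecord F N U₀)) (A - B))) : Space115Lit F N K k Ω U₀) =
      (JetSup.equiv _ _ (nabla115 ((F.P K).eta k) (unitsOfRecord F N U₀))).symm
          (star (JetSup.equiv _ _ (nabla115 ((F.P K).eta k) (unitsOfRecord F N U₀)) A)) -
        (JetSup.equiv _ _ (nabla115 ((F.P K).eta k) (unitsOfRecord F N U₀))).symm
          (star (JetSup.equiv _ _ (nabla115 ((F.P K).eta k) (unitsOfRecord F N U₀)) B)) := by
  apply (JetSup.equiv _ _ (nabla115 ((F.P K).eta k) (unitsOfRecord F N U₀))).injective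
  rw [Equiv.apply_symm_apply, JetSup.equiv_sub, JetSup.equiv_sub, Equiv.apply_symm_apply, Equiv.apply_symm_apply, star_sub]

/-- `(c•A)ᴴ = c̄•Aᴴ` on the space (115) of record. [cite: Balaban1985Variational, (115) p.294 (bookkeeping)] -/
theorem conjJet_smul (c : ℂ) (A : Space115Lit F N K k Ω U₀) :
    ((JetSup.equiv _ _ (nabla115 ((F.P K).eta k) (unitsOfRecord F N U₀))).symm
        (star (JetSup.equiv _ _ (nabla115 ((F.P K).eta k) (unitsOfRecord F N U₀)) (c • A))) : Space115Lit F N K k Ω U₀) =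
      conj c • (JetSup.equiv _ _ (nabla115 ((F.P K).eta k) (unitsOfRecord F N U₀))).symm
          (star (JetSup.equiv _ _ (nabla115 ((F.P K).eta k) (unitsOfRecord F N U₀)) A)) := by
  apply (JetSup.equiv _ _ (nabla115 ((F.P K).eta k) (unitsOfRecord F N U₀))).injective
  rw [Equiv.apply_symm_apply, JetSup.equiv_smul, JetSup.equiv_smul, Equiv.apply_symm_apply, star_smul, Complex.star_def]

/-- `Aᴴᴴ = A` on the space (115) of record. [cite: Balaban1985Variational, (115) p.294 (bookkeeping)] -/
theorem conjJet_conjJet (A : Space115Lit F N K k Ω U₀) :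
    ((JetSup.equiv _ _ (nabla115 ((F.P K).eta k) (unitsOfRecord F N U₀))).symm
        (star (JetSup.equiv _ _ (nabla115 ((F.P K).eta k) (unitsOfRecord F N U₀))
          (((JetSup.equiv _ _ (nabla115 ((F.P K).eta k) (unitsOfRecord F N U₀))).symm
            (star (JetSup.equiv _ _ (nabla115 ((F.P K).eta k) (unitsOfRecord F N U₀)) A)) : Space115Lit F N K k Ω U₀)))) :
        Space115Lit F N K k Ω U₀) = A := by
  rw [Equiv.apply_symm_apply, star_star, Equiv.symm_apply_apply]

variable (levB : PBond (F.P K) k → ℕ)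

/-- `(Z + Z')ᴴ = Zᴴ + Z'ᴴ` on the block fields. [cite: Balaban1985Variational, (103) p.293 (bookkeeping)] -/
theorem conjNeg_add (Z Z' : NegSize (F.L : ℝ) ((F.P K).eta k) levB 0 (Matrix (Fin N) (Fin N) ℂ)) :
    ((NegSup.equiv _ _).symm (star (NegSup.equiv _ _ (Z + Z'))) : NegSize (F.L : ℝ) ((F.P K).eta k) levB 0 (Matrix (Fin N) (Fin N) ℂ)) =
      (NegSup.equiv _ _).symm (star (NegSup.equiv _ _ Z)) + (NegSup.equiv _ _).symm (star (NegSup.equiv _ _ Z')) := by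
  apply (NegSup.equiv _ _).injective
  rw [Equiv.apply_symm_apply, NegSup.equiv_add, NegSup.equiv_add, Equiv.apply_symm_apply, Equiv.apply_symm_apply, star_add]

/-- `(c•Z)ᴴ = c̄•Zᴴ` on the block fields. [cite: Balaban1985Variational, (103) p.293 (bookkeeping)] -/
theorem conjNeg_smul (c : ℂ) (Z : NegSize (F.L : ℝ) ((F.P K).eta k) levB 0 (Matrix (Fin N) (Fin N) ℂ)) :
    ((NegSup.equiv _ _).symm (star (NegSup.equiv _ _ (c • Z))) : NegSize (F.L : ℝ) ((F.P K).eta k) levB 0 (Matrix (Fin N) (Fin N) ℂ)) =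
      conj c • (NegSup.equiv _ _).symm (star (NegSup.equiv _ _ Z)) := by
  apply (NegSup.equiv _ _).injective
  rw [Equiv.apply_symm_apply, NegSup.equiv_smul, NegSup.equiv_smul, Equiv.apply_symm_apply, star_smul, Complex.star_def]

/-- `(r•Z)ᴴ = r•Zᴴ` on the block fields for REAL `r`. [cite: Balaban1985Variational, (103) p.293 (bookkeeping)] -/
theorem conjNeg_real_smul (r : ℝ) (Z : NegSize (F.L : ℝ) ((F.P K).eta k) levB 0 (Matrix (Fin N) (Fin N) ℂ)) :
    ((NegSup.equiv _ _).symm (star (NegSup.equiv _ _ (r • Z))) : NegSize (F.L : ℝ) ((F.P K).eta k) levB 0 (Matrix (Fin N) (Fin N) ℂ)) =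
      r • (NegSup.equiv _ _).symm (star (NegSup.equiv _ _ Z)) := by
  apply (NegSup.equiv _ _).injective
  rw [Equiv.apply_symm_apply, NegSup.equiv_smul, NegSup.equiv_smul, Equiv.apply_symm_apply, star_smul, star_trivial]

/-- `(Z − Z')ᴴ = Zᴴ − Z'ᴴ` on the block fields. [cite: Balaban1985Variational, (103) p.293 (bookkeeping)] -/
theorem conjNeg_sub (Z Z' : NegSize (F.L : ℝ) ((F.P K).eta k) levB 0 (Matrix (Fin N) (Fin N) ℂ)) :
    ((NegSup.equiv _ _).symm (star (NegSup.equiv _ _ (Z - Z'))) : NegSize (F.L : ℝ) ((F.P K).eta k) levB 0 (Matrix (Fin N) (Fin N) ℂ)) =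
      (NegSup.equiv _ _).symm (star (NegSup.equiv _ _ Z)) - (NegSup.equiv _ _).symm (star (NegSup.equiv _ _ Z')) := by
  apply (NegSup.equiv _ _).injective
  rw [Equiv.apply_symm_apply, NegSup.equiv_sub, NegSup.equiv_sub, Equiv.apply_symm_apply, Equiv.apply_symm_apply, star_sub]

end Conj

/-! ## §3  The second derivative along Hermitian directions is Hermitian -/

section Herm

variable (F : T4Family) (N : ℕ) [NeZero N] (K : ℕ) (k : ℕ) (Ω : ℕ → Set (Site (F.P K) 0)) (U₀ : GaugeField (F.P K) 0 (SU N))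
  [Fact (0 < (F.L : ℝ))] [Fact (0 < (F.P K).eta k)] (levB : PBond (F.P K) k → ℕ)

omit [NeZero N] in
/-- The real line through `A′`: `t ↦ (t:ℂ)•A′` has velocity `A′`. [folklore] -/
theorem hasDerivAt_realLine (A : Space115Lit F N K k Ω U₀) (t : ℝ) : HasDerivAt (fun s : ℝ => ((s : ℂ)) • A) A t := by
  have h := ((hasDerivAt_id t).ofReal_comp).smul_const A
  rw [Complex.ofReal_one, one_smul] at h
  exact h

omit [NeZero N] in
/-- **THE BLOCK CONJUGATION IS CONTINUOUS** (a real-linear map of a finite-dimensional space). [folklore] -/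
theorem continuous_conjNeg :
    Continuous fun Z : NegSize (F.L : ℝ) ((F.P K).eta k) levB 0 (Matrix (Fin N) (Fin N) ℂ) =>
      ((NegSup.equiv _ _).symm (star (NegSup.equiv _ _ Z)) : NegSize (F.L : ℝ) ((F.P K).eta k) levB 0 (Matrix (Fin N) (Fin N) ℂ)) := by
  let σ : NegSize (F.L : ℝ) ((F.P K).eta k) levB 0 (Matrix (Fin N) (Fin N) ℂ) →ₗ[ℝ] NegSize (F.L : ℝ) ((F.P K).eta k) levB 0 (Matrix (Fin N) (Fin N) ℂ) :=
    { toFun := fun Z => (NegSup.equiv _ _).symm (star (NegSup.equiv _ _ Z))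
      map_add' := fun Z Z' => conjNeg_add F N K k levB Z Z'
      map_smul' := fun r Z => by rw [RingHom.id_apply, conjNeg_real_smul] }
  exact σ.continuous_of_finiteDimensional

/-- ★★ **`(D²C^{𝔰𝔩}(0)(A′, A′))ᴴ = D²C^{𝔰𝔩}(0)(A′, A′)` FOR A HERMITIAN DIRECTION `A′`** (guard): the curve `t ↦ C^{𝔰𝔩}(tA′)` is Hermitian-valued near `0`
(✓`CslOfRecord_line_conj_eventually`), hence so are its first derivatives `DC^{𝔰𝔩}(tA′)A′` near `0` and the second derivative at `0` (§1 twice; `C^{𝔰𝔩}` analytic near `0`,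
✓`analyticAt_CslOfRecord_zero`). [cite: Balaban1985Variational, (44) p.285, (56) p.286, (78) p.290] -/
theorem conjNeg_sndFDeriv_of_herm (hU₀ : SmallBelow (avOfRecord F N K) k U₀) {A : Space115Lit F N K k Ω U₀}
    (hA : ((JetSup.equiv _ _ (nabla115 ((F.P K).eta k) (unitsOfRecord F N U₀))).symm
        (star (JetSup.equiv _ _ (nabla115 ((F.P K).eta k) (unitsOfRecord F N U₀)) A)) : Space115Lit F N K k Ω U₀) = A) :
    ((NegSup.equiv _ _).symm (star (NegSup.equiv _ _ (fderiv ℂ (fderiv ℂ (CslOfRecord F N K k Ω U₀ levB)) 0 A A))) :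
        NegSize (F.L : ℝ) ((F.P K).eta k) levB 0 (Matrix (Fin N) (Fin N) ℂ)) =
      fderiv ℂ (fderiv ℂ (CslOfRecord F N K k Ω U₀ levB)) 0 A A := by
  -- letters
  set f : Space115Lit F N K k Ω U₀ → NegSize (F.L : ℝ) ((F.P K).eta k) levB 0 (Matrix (Fin N) (Fin N) ℂ) := CslOfRecord F N K k Ω U₀ levB with hf
  set σ : NegSize (F.L : ℝ) ((F.P K).eta k) levB 0 (Matrix (Fin N) (Fin N) ℂ) → NegSize (F.L : ℝ) ((F.P K).eta k) levB 0 (Matrix (Fin N) (Fin N) ℂ) :=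
    fun Z => (NegSup.equiv _ _).symm (star (NegSup.equiv _ _ Z)) with hσ
  have hσc : Continuous σ := continuous_conjNeg F N K k levB
  have hσlin : ∀ (r : ℝ) (a b : NegSize (F.L : ℝ) ((F.P K).eta k) levB 0 (Matrix (Fin N) (Fin N) ℂ)), σ (r • (a - b)) = r • (σ a - σ b) := fun r a b => by
    simp only [hσ]
    rw [conjNeg_real_smul, conjNeg_sub]
  -- the presented field of `A′` is Hermitian
  have hA' : ∀ b, star (evLit F N K k Ω U₀ A b) = evLit F N K k Ω U₀ A b := fun b => by
    have h := congrArg (fun B : Space115Lit F N K k Ω U₀ => JetSup.equiv _ _ (nabla115 ((F.P K).eta k) (unitsOfRecord F N U₀)) B (bondToLit (F.P K) 0 b)) hA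
    simpa only [Equiv.apply_symm_apply, Pi.star_apply, evLit_apply] using h
  -- analyticity near `0`
  have han : AnalyticAt ℂ f 0 := analyticAt_CslOfRecord_zero F N K k Ω U₀ levB hU₀
  have hg : HasFDerivAt (fderiv ℂ f) (fderiv ℂ (fderiv ℂ f) 0) 0 := han.fderiv.differentiableAt.hasFDerivAt
  have hline0 : Tendsto (fun s : ℝ => ((s : ℂ)) • A) (𝓝 0) (𝓝 0) := by
    have hc : Continuous fun s : ℝ => ((s : ℂ)) • A := (Complex.continuous_ofReal.smul continuous_const)
    simpa only [Complex.ofReal_zero, zero_smul] using hc.tendsto 0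
  have hdiff : ∀ᶠ t : ℝ in 𝓝 0, HasFDerivAt f (fderiv ℂ f (((t : ℂ)) • A)) (((t : ℂ)) • A) :=
    (hline0.eventually han.eventually_analyticAt).mono fun t ht => ht.differentiableAt.hasFDerivAt
  -- (a) the first derivatives along the line are Hermitian near `0`
  have hreal : ∀ᶠ t : ℝ in 𝓝 0, σ (f (((t : ℂ)) • A)) = f (((t : ℂ)) • A) := CslOfRecord_line_conj_eventually F N K k Ω U₀ levB hU₀ hA'
  have hfirst : ∀ᶠ t : ℝ in 𝓝 0, σ (fderiv ℂ f (((t : ℂ)) • A) A) = fderiv ℂ f (((t : ℂ)) • A) A := by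
    filter_upwards [hdiff, hreal.eventually_nhds] with t ht hreal_t
    have hcurve : HasDerivAt (fun s : ℝ => f (((s : ℂ)) • A)) (fderiv ℂ f (((t : ℂ)) • A) A) t := by
      have h := (ht.restrictScalars ℝ).comp_hasDerivAt t (hasDerivAt_realLine F N K k Ω U₀ A t)
      simpa only [Function.comp_def, ContinuousLinearMap.coe_restrictScalars'] using h
    exact fixed_of_hasDerivAt hσc hσlin hreal_t hcurve
  -- (b) the second derivative at `0`
  have hsecond : HasDerivAt (fun s : ℝ => fderiv ℂ f (((s : ℂ)) • A) A) (fderiv ℂ (fderiv ℂ f) 0 A A) 0 := by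
    have hγ := hasDerivAt_realLine F N K k Ω U₀ A 0
    -- `x ↦ Df(x)A′` is ℂ-differentiable at `0` with derivative `x ↦ D²f(0)(x)A′`
    have hev : HasFDerivAt (fun x => fderiv ℂ f x A) ((ContinuousLinearMap.apply ℂ (NegSize (F.L : ℝ) ((F.P K).eta k) levB 0 (Matrix (Fin N) (Fin N) ℂ)) A).comp (fderiv ℂ (fderiv ℂ f) 0)) (((0 : ℝ) : ℂ) • A) := by
      rw [Complex.ofReal_zero, zero_smul]
      exact (ContinuousLinearMap.apply ℂ (NegSize (F.L : ℝ) ((F.P K).eta k) levB 0 (Matrix (Fin N) (Fin N) ℂ)) A).hasFDerivAt.comp (0 : Space115Lit F N K k Ω U₀) hg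
    have h := (hev.restrictScalars ℝ).comp_hasDerivAt (0 : ℝ) hγ
    simpa only [Function.comp_def, ContinuousLinearMap.coe_restrictScalars', ContinuousLinearMap.coe_comp, ContinuousLinearMap.apply_apply] using h
  exact fixed_of_hasDerivAt hσc hσlin hfirst hsecond

end Herm

/-! ## §4  Polarisation: the letter `hC2` -/

section Polar

variable (F : T4Family) (N : ℕ) [NeZero N] (K : ℕ) (k : ℕ) (Ω : ℕ → Set (Site (F.P K) 0)) (U₀ : GaugeField (F.P K) 0 (SU N))
  [Fact (0 < (F.L : ℝ))] [Fact (0 < (F.P K).eta k)] (levB : PBond (F.P K) k → ℕ)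

/-- ★★★ **THE LETTER `hC2`: `quadPart C^{𝔰𝔩} (A′ᴴ) = (quadPart C^{𝔰𝔩} A′)ᴴ` FOR EVERY `A′`** at a guarded background — write `A′ = A₁ + iA₂` with `A₁ = ½(A′ + A′ᴴ)`,
`A₂ = (2i)⁻¹(A′ − A′ᴴ)` Hermitian, expand the ℂ-bilinear `D²C^{𝔰𝔩}(0)` and use §3 on `A₁`, `A₂`, `A₁ + A₂`.
[cite: Balaban1985Variational, (56) p.286, (78)–(79) p.290; Balaban1985BackgroundPropagators, (3.134) p.422] -/
theorem quadPart_CslOfRecord_conj (hU₀ : SmallBelow (avOfRecord F N K) k U₀) (A : Space115Lit F N K k Ω U₀) :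
    quadPart (CslOfRecord F N K k Ω U₀ levB)
        ((JetSup.equiv _ _ (nabla115 ((F.P K).eta k) (unitsOfRecord F N U₀))).symm
          (star (JetSup.equiv _ _ (nabla115 ((F.P K).eta k) (unitsOfRecord F N U₀)) A))) =
      (NegSup.equiv _ _).symm (star (NegSup.equiv _ _ (quadPart (CslOfRecord F N K k Ω U₀ levB) A))) := by
  -- letters: the bilinear second derivative `L x y = D²f(0)(x, y)` and the two conjugations
  set L : Space115Lit F N K k Ω U₀ →L[ℂ] Space115Lit F N K k Ω U₀ →L[ℂ] NegSize (F.L : ℝ) ((F.P K).eta k) levB 0 (Matrix (Fin N) (Fin N) ℂ) :=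
    fderiv ℂ (fderiv ℂ (CslOfRecord F N K k Ω U₀ levB)) 0 with hL
  set σ : NegSize (F.L : ℝ) ((F.P K).eta k) levB 0 (Matrix (Fin N) (Fin N) ℂ) → NegSize (F.L : ℝ) ((F.P K).eta k) levB 0 (Matrix (Fin N) (Fin N) ℂ) :=
    fun Z => (NegSup.equiv _ _).symm (star (NegSup.equiv _ _ Z)) with hσ
  set τ : Space115Lit F N K k Ω U₀ → Space115Lit F N K k Ω U₀ :=
    fun B => (JetSup.equiv _ _ (nabla115 ((F.P K).eta k) (unitsOfRecord F N U₀))).symm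
      (star (JetSup.equiv _ _ (nabla115 ((F.P K).eta k) (unitsOfRecord F N U₀)) B)) with hτ
  have hquad : ∀ y : Space115Lit F N K k Ω U₀, quadPart (CslOfRecord F N K k Ω U₀ levB) y = (2 : ℂ)⁻¹ • L y y := fun y => by
    rw [quadPart, iteratedFDeriv_two_apply]
  -- the algebra of the conjugations
  have hσ_add : ∀ Z Z', σ (Z + Z') = σ Z + σ Z' := conjNeg_add F N K k levB
  have hσ_sub : ∀ Z Z', σ (Z - Z') = σ Z - σ Z' := conjNeg_sub F N K k levB
  have hσ_smul : ∀ (c : ℂ) Z, σ (c • Z) = conj c • σ Z := conjNeg_smul F N K k levB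
  have hτ_add : ∀ B B', τ (B + B') = τ B + τ B' := conjJet_add F N K k Ω U₀
  have hτ_sub : ∀ B B', τ (B - B') = τ B - τ B' := conjJet_sub F N K k Ω U₀
  have hτ_smul : ∀ (c : ℂ) B, τ (c • B) = conj c • τ B := conjJet_smul F N K k Ω U₀
  have hττ : τ (τ A) = A := conjJet_conjJet F N K k Ω U₀ A
  have hI : Complex.I * (2 * Complex.I)⁻¹ = (2 : ℂ)⁻¹ := by
    rw [mul_inv, mul_comm (2 : ℂ)⁻¹, ← mul_assoc, mul_inv_cancel₀ Complex.I_ne_zero, one_mul]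
  -- the Hermitian parts
  set A₁ : Space115Lit F N K k Ω U₀ := (2 : ℂ)⁻¹ • (A + τ A) with hA₁
  set A₂ : Space115Lit F N K k Ω U₀ := (2 * Complex.I)⁻¹ • (A - τ A) with hA₂
  have h2 : conj ((2 : ℂ)⁻¹) = (2 : ℂ)⁻¹ := by rw [map_inv₀, map_ofNat]
  have h2I : conj ((2 * Complex.I)⁻¹) = -(2 * Complex.I)⁻¹ := by
    rw [map_inv₀, map_mul, map_ofNat, Complex.conj_I, mul_neg, inv_neg]
  have hA₁r : τ A₁ = A₁ := by
    rw [hA₁, hτ_smul, h2, hτ_add, hττ, add_comm]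
  have hA₂r : τ A₂ = A₂ := by
    rw [hA₂, hτ_smul, h2I, hτ_sub, hττ, neg_smul, ← smul_neg, neg_sub]
  have hA₁₂r : τ (A₁ + A₂) = A₁ + A₂ := by rw [hτ_add, hA₁r, hA₂r]
  have hdecomp : A = A₁ + Complex.I • A₂ := by
    rw [hA₁, hA₂, smul_smul, hI]
    module
  have hdecomp' : τ A = A₁ - Complex.I • A₂ := by
    rw [hA₁, hA₂, smul_smul, hI]
    module
  clear_value A₁ A₂
  -- §3 on the three Hermitian directions
  have hH₁ : σ (L A₁ A₁) = L A₁ A₁ := conjNeg_sndFDeriv_of_herm F N K k Ω U₀ levB hU₀ hA₁r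
  have hH₂ : σ (L A₂ A₂) = L A₂ A₂ := conjNeg_sndFDeriv_of_herm F N K k Ω U₀ levB hU₀ hA₂r
  have hH₁₂ : σ (L (A₁ + A₂) (A₁ + A₂)) = L (A₁ + A₂) (A₁ + A₂) := conjNeg_sndFDeriv_of_herm F N K k Ω U₀ levB hU₀ hA₁₂r
  have hLadd : ∀ x y z : Space115Lit F N K k Ω U₀, L (x + y) z = L x z + L y z := fun x y z => by rw [map_add]; rfl
  have hLadd' : ∀ x y z : Space115Lit F N K k Ω U₀, L x (y + z) = L x y + L x z := fun x y z => map_add _ _ _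
  have hLsmul : ∀ (c : ℂ) (x z : Space115Lit F N K k Ω U₀), L (c • x) z = c • L x z := fun c x z => by rw [map_smul]; rfl
  have hLsmul' : ∀ (c : ℂ) (x z : Space115Lit F N K k Ω U₀), L x (c • z) = c • L x z := fun c x z => map_smul _ _ _
  have hM : σ (L A₁ A₂ + L A₂ A₁) = L A₁ A₂ + L A₂ A₁ := by
    have hexp : L (A₁ + A₂) (A₁ + A₂) = L A₁ A₁ + L A₂ A₂ + (L A₁ A₂ + L A₂ A₁) := by
      rw [hLadd, hLadd', hLadd']; abel
    have h := hH₁₂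
    rw [hexp, hσ_add, hσ_add, hH₁, hH₂] at h
    exact add_left_cancel h
  -- expand both sides
  have hLA : L A A = (L A₁ A₁ - L A₂ A₂) + Complex.I • (L A₁ A₂ + L A₂ A₁) := by
    rw [hdecomp]
    simp only [hLadd, hLadd', hLsmul, hLsmul', smul_smul, Complex.I_mul_I]
    module
  have hLτ : L (τ A) (τ A) = (L A₁ A₁ - L A₂ A₂) - Complex.I • (L A₁ A₂ + L A₂ A₁) := by
    rw [hdecomp', sub_eq_add_neg, ← neg_smul]
    simp only [hLadd, hLadd', hLsmul, hLsmul', smul_smul, neg_mul_neg, Complex.I_mul_I]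
    module
  show quadPart (CslOfRecord F N K k Ω U₀ levB) (τ A) = σ (quadPart (CslOfRecord F N K k Ω U₀ levB) A)
  rw [hquad, hquad, hσ_smul, h2, hLA, hLτ, hσ_add, hσ_sub, hH₁, hH₂, hσ_smul, Complex.conj_I, hM]
  module

end Polar

/-! ## §5  `HessSymmTok Δ2` for the (3.134) datum, no nonlinear letter left -/

section Final

variable (F : T4Family) (N : ℕ) [NeZero N] (K : ℕ) (k : ℕ) (Ω : ℕ → Set (Site (F.P K) 0)) (U₀ : GaugeField (F.P K) 0 (SU N))
  [Fact (0 < (F.L : ℝ))] [Fact (0 < (F.P K).eta k)] [Fact (0 < c0Rec F K k)] [Fact (∀ c, 0 < wBRec F K k c)]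
  (levB : PBond (F.P K) k → ℕ) (a : ℝ)
  (hposb : ∀ x, x ≠ 0 → 0 < RCLike.re ⟪x, laplaceAOfRecord F N k U₀ (QOfRecord F N k U₀) (QflatOfRecord F N k) a x⟫_ℂ)
  (hQ : Function.Surjective (QOfRecord F N k U₀))

/-- ★★★ **THE (3.134) DATUM `Δ⁽²⁾` IS REAL** at every guarded background: `⋆Δ2⋆ = Δ2` for every `Δ2` with `Delta2Tok ∧ Delta2SymmTok`.
[cite: Balaban1985BackgroundPropagators, (3.134)–(3.135) p.422, p.392; Balaban1985Variational, (27) p.282, (56) p.286, (78)–(79) p.290] -/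
theorem realConj_delta2_eq_self (h : SmallBelow (avOfRecord F N K) k U₀)
    {Δ2 : BondL2K ℂ (F.P K).d (fun _ => (F.P K).sitesPerDir 0) (c0Rec F K k) (WRec N) →ₗ[ℂ]
      BondL2K ℂ (F.P K).d (fun _ => (F.P K).sitesPerDir 0) (c0Rec F K k) (WRec N)}
    (hΔ : Delta2Tok F N K k Ω U₀ levB a hposb hQ Δ2) (hs : Delta2SymmTok F N K k Ω U₀ Δ2) : realConj (phiRec N) Δ2 = Δ2 :=
  realConj_eq_self_of_delta2Tok F N K k Ω U₀ levB a hposb hQ h (quadPart_CslOfRecord_conj F N K k Ω U₀ levB h) hΔ hs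

/-- ★★★ **3g′'s TOKEN `HessSymmTok Δ2` FOR THE (3.134) DATUM, AT EVERY GUARDED BACKGROUND, NO NONLINEAR LETTER LEFT**: for every `Δ2` carrying `Delta2Tok ∧ Delta2SymmTok`
(such a `Δ2` exists ✓p820290 and is unique ✓p820429), `Δ(U₀) + Δ⁽²⁾` is Hilbert-symmetric.  Binders: 35b's guard, and the scheme's own `hpos♭`, `hQ` inside `Delta2Tok`.
[cite: Balaban1985BackgroundPropagators, (3.124) p.420, (3.128) p.421, (3.134)–(3.135) p.422; Balaban1985Variational, Prop. 6 p.295] -/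
theorem hessSymmTok_of_delta2Tok_of_delta2SymmTok (h : SmallBelow (avOfRecord F N K) k U₀)
    {Δ2 : BondL2K ℂ (F.P K).d (fun _ => (F.P K).sitesPerDir 0) (c0Rec F K k) (WRec N) →ₗ[ℂ]
      BondL2K ℂ (F.P K).d (fun _ => (F.P K).sitesPerDir 0) (c0Rec F K k) (WRec N)}
    (hΔ : Delta2Tok F N K k Ω U₀ levB a hposb hQ Δ2) (hs : Delta2SymmTok F N K k Ω U₀ Δ2) : HessSymmTok F N K k U₀ Δ2 :=
  hessSymmTok_of_delta2Tok F N K k Ω U₀ levB a hposb hQ h (quadPart_CslOfRecord_conj F N K k Ω U₀ levB h) hΔ hs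

end Final

end Summit.QuantumFields.YangMills.Theorems.N07QuadPartReality

end
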